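import Literature.MathematicalPhysics.QuantumFieldTheory.Balaban1983to89.B16Improved189FullBudgetIndex

/-!
# `Balaban1983to89.B16Improved189FullBudgetClauses` — [Balaban1989LargeFieldII] pp. 384–387: the LOCATED CLAUSES of the
full-budget route (`B16Improved189FullBudget`, `B16Improved189FullBudgetIndex`, `B16Improved189ArbitraryRegionFull`) are
`g_k`-UNIFORM — each follows from print's own located condition with its constant changed plus ONE smallness of `κ₁` by
constants (`O(1)`, `M`, `L`, `d`, `Nsz`, `r₀`), using only `R_n ≥ 1`

T. Bałaban, *Large field renormalization. II. Localization, exponentiation, and bounds for the 𝐑 operation*, Commun.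
Math. Phys. **122** (1989) 355–392, doi:10.1007/bf01238433 [Balaban1989LargeFieldII] (cell paper B16 = [V]; PDF held
`paper:balaban1989-cmp122-large-field-ii`, journal page = PDF page + 354).  [III] = [Balaban1988Convergent] (2.5), (2.9).

statement-level bookkeeping of a published proof with citation tags; proofs kernel-checked; nothing here is a claim
about the Yang–Mills mass gap

CITATION HEADER ∕ WHAT IS PRINTED.  p. 385 [PDF 31]: *"Thus, by the estimate (1.81), the statement holds for j = 1 … if
[¼γ₀(14)^{−d}A₁²p₀²(g₁) ≧ O(1)2(64)^dM^dL^{d+1}R₁^{d+2}]. This condition is satisfied for p₀ large, and g₁ sufficiently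
small."*; p. 387 [PDF 33] l. 16: *"(1.88) for p₀ large and γ small enough."*; p. 389 [PDF 35]: *"1 + 2κ(100R_k)^d ≦
¼p₀(g_k)"* (the printed trade of a `(const·R)^d`-term against the `p₀`-budget, needed by the HALF-budget route only).

WHY THIS FILE.  The half-budget repairs of GAPS G-adv3-6 (2) (`B16Improved189.size_trade_of_exponents`,
`B16Improved189ArbitraryRegion.deficit_trade_of_exponents`) pay a `(const·R_k)^d`-term from the `p₀(g_k)`-budget and are
therefore `g_k`-SMALLNESS conditions (exponent relation `p₀ ≥ d·r₀ + 1`, `log g_k⁻²` large).  The full-budget route replaces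
them by four located clauses whose headers say «constants only»; THIS FILE makes that kernel-checked: with `R_n ≥ 1` and the
cost exponent `d_b = d`, every new clause is implied by print's OWN located condition at the same place with its numerical
constant enlarged, plus a smallness of `κ₁` against `O(1)M^d` and powers of `L`, `Nsz`, `r₀` — NO `g_k`, NO `p₀`:
(C1) the birth∕base clause `κ₁((Nsz·L·R_m)^d − 1) ≤ Q_m`, `Q_m = 10·126^d·O(1)M^dL^{d+1}R_m^{d+2}`
(`B16Improved189FullBudgetIndex.invariantT_base_ofIndex`'s `hclauseU`) ⇐ `κ₁(Nsz·L)^d ≤ 10·126^d·O(1)M^dL^{d+1}`;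
(C2) the reset clause `2(2r₀+21)^d·Q′ + κ₁((Nsz·R_{j+1+K})^d − 1) ≤ p₀(g_j)` (`controlsT_reset_ofIndex`'s `hcondRT`) ⇐ print's
reset condition with `2(2r₀+21)^d + 1` for `2(2r₀+21)^d` and `κ₁(Nsz·L)^d ≤ O(1)M^dL^{d+1}`;
(C3) the merger clause `E + E_t + cost(2) ≤ q`, `E_t = κ₁((Nsz·L·R_{j+1})^d − 1)` (`mergeT_controls_ofIndex`'s `hbudgetT`) ⇐
print's `E + cost(3) ≤ q` («+2d» junction constant `2 ↦ 3`) and `κ₁(Nsz·L)^d ≤ O(1)M^d`;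
(C4) the doubled slope clause `2κ₁cL^d ≤ O(1)M^dR_{k+1}` (`B16Improved189ArbitraryRegionFull`'s `hslope2`) ⇐ `2κ₁cL^d ≤
O(1)M^d`.  The remaining inputs of the route are print's: `3Q ≤ a` for `2Q ≤ a` (p. 385), `c₀ ≤ P` ((2.7a),
`Step.Budget.profile_slack_le`).

WHAT THIS FILE PROVES (kernel-checked, zero `sorry`, theorems only; axioms standard; pure real arithmetic — nothing of the
siblings re-proved): §1 `constPow_sub_one_le` (`(A·R)^d − 1 ≤ A^d·R^{d+e}` for `R ≥ 1`, `A ≥ 0`); §2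
**`hclauseU_of_small_kappa`** (C1); §3 **`hcondRT_of_small_kappa`** (C2); §4 `terminalConst_le_cost_one`,
**`hbudgetT_of_small_kappa`** (C3); §5 **`hslope2_of_small_kappa`** (C4); §6 `toy_clauses_fullBudget` (the four smallness conditions and
print's located conditions jointly inhabited by explicit numbers — A6).
HONEST SCOPE.  Arithmetic about the cell's bookkeeping constants (`Step.Budget.Consts`: `O(1) = C`, `M`, `d_b`, `R_n`);
`R_n ≥ 1` is (2.5) [III] (`R_n = L^{σ_n}`); which numerical constants print's «O(1)» hides is not fixed by the text, so
«constant enlarged» is the honest reading of «for p₀ large and γ small enough»; nothing of (1.79)–(1.89) asserted; N13 NOT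
discharged; count-neutral; one finite 𝕋⁴ programme at fixed ε, Bałaban AS PRINTED; R4 closes the conditional finite-𝕋⁴
rung `BalabanLadder.UV` only — nothing continuum ∕ OS ∕ mass gap ∕ Clay.  Seat `pub-ymgap-dag-n13-w2` (g0), YM-DAG node
N13 [B16] Cor. 3, W-SEAT-START-LIST §1 n13 item 2, `--supports stmt-QuantumFields-20542`.
-/

noncomputable section

namespace Literature.MathematicalPhysics.QuantumFieldTheory.Balaban1983to89.B16Improved189FullBudgetClauses

open Literature.MathematicalPhysics.QuantumFieldTheory.Balaban1983to89
open Literature.MathematicalPhysics.QuantumFieldTheory.Balaban1983to89.Step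
open Literature.MathematicalPhysics.QuantumFieldTheory.Balaban1983to89.Step.Budget

/-! ## §1. One arithmetic fact: `(A·R)^d − 1 ≤ A^d·R^{d+e}` for `R ≥ 1` -/

/-- For `A ≥ 0`, `R ≥ 1`: `(A·R)^d − 1 ≤ A^d·R^{d+e}` — a `(const·R)^d`-term at a scale is dominated by the same constant
times ANY higher power of `R` (here the `R^{d+1}`, `R^{d+2}` of the cost terms), because `R_n ≥ 1` ((2.5) [III]). [folklore]
[cite: Balaban1988Convergent, (2.5) p.255] -/
theorem constPow_sub_one_le {A R : ℝ} (hA : 0 ≤ A) (hR : 1 ≤ R) (d e : ℕ) :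
    (A * R) ^ d - 1 ≤ A ^ d * R ^ (d + e) := by
  have hR0 : 0 ≤ R := by linarith
  have h1 : (A * R) ^ d = A ^ d * R ^ d := mul_pow A R d
  have h2 : R ^ d ≤ R ^ (d + e) := pow_le_pow_right₀ hR (Nat.le_add_right d e)
  have h3 : A ^ d * R ^ d ≤ A ^ d * R ^ (d + e) := mul_le_mul_of_nonneg_left h2 (pow_nonneg hA d)
  linarith

/-! ## §2. (C1) The birth∕base clause of `invariantT_base_ofIndex` -/

/-- **(C1) THE BASE CLAUSE IS `g`-UNIFORM**: with `R_m ≥ 1`, `d_b = d` and non-negative constants, the clause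
`κ₁((Nsz·L·R_m)^d − 1) ≤ 10·126^d·O(1)M^{d_b}L^{d_b+1}R_m^{d_b+2}` of `B16Improved189FullBudgetIndex.invariantT_base_ofIndex`
(`hclauseU`; in `controlsT_birth_ofIndex` per component via `terminal_pow_le_of_flow`) follows from the smallness
`κ₁·(Nsz·L)^d ≤ 10·126^d·O(1)·M^d·L^{d+1}` of `κ₁` — constants only, no `g_m`, no `p₀`. [cite: Balaban1989LargeFieldII, (1.82) p.385 («for p₀ large, and g₁ sufficiently small»)] -/
theorem hclauseU_of_small_kappa (b : Budget.Consts) {d m : ℕ} (hdim : b.d = d)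
    {L Nsz : ℕ} (hR1 : 1 ≤ b.R m) {κ₁ : ℝ} (hκ₁ : 0 ≤ κ₁)
    (hsmall : κ₁ * ((Nsz : ℝ) * L) ^ d ≤ 10 * 126 ^ d * (b.C * b.M ^ d * (L : ℝ) ^ (d + 1))) :
    κ₁ * (((Nsz : ℝ) * L * b.R m) ^ d - 1) ≤
      10 * 126 ^ d * (b.C * b.M ^ b.d * (L : ℝ) ^ (b.d + 1) * b.R m ^ (b.d + 2)) := by
  rw [hdim]
  have hA : (0 : ℝ) ≤ (Nsz : ℝ) * L := by positivity
  have h1 := constPow_sub_one_le hA hR1 d 2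
  have hRp : 0 ≤ b.R m ^ (d + 2) := pow_nonneg (by linarith) _
  calc κ₁ * (((Nsz : ℝ) * L * b.R m) ^ d - 1)
      ≤ κ₁ * (((Nsz : ℝ) * L) ^ d * b.R m ^ (d + 2)) := mul_le_mul_of_nonneg_left h1 hκ₁
    _ = (κ₁ * ((Nsz : ℝ) * L) ^ d) * b.R m ^ (d + 2) := by ring
    _ ≤ (10 * 126 ^ d * (b.C * b.M ^ d * (L : ℝ) ^ (d + 1))) * b.R m ^ (d + 2) :=
        mul_le_mul_of_nonneg_right hsmall hRp
    _ = 10 * 126 ^ d * (b.C * b.M ^ d * (L : ℝ) ^ (d + 1) * b.R m ^ (d + 2)) := by ring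

/-! ## §3. (C2) The reset clause of `controlsT_reset_ofIndex` -/

/-- **(C2) THE RESET CLAUSE IS `g`-UNIFORM UP TO PRINT'S OWN CONDITION**: with `R_{j+1} ≥ 1`, `R_{j+1+K} ≤ L·R_{j+1}` ((2.9)
first member), `d_b = d`: the clause `2(2r₀+21)^d·Q′ + κ₁((Nsz·R_{j+1+K})^d − 1) ≤ p` of
`B16Improved189FullBudgetIndex.controlsT_reset_ofIndex` (`Q′ = O(1)M^{d_b}L^{d_b+1}R_{j+1}^{d_b+2}`) follows from print's reset
condition with the constant `2(2r₀+21)^d + 1` (`hcondR'`: «the fresh factor exp(−p₀(g_j)) pays the small domain's costs»,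
p. 386, with `B16Lem384Induction` §10's constant enlarged by one unit of `Q′`) and the smallness `κ₁(Nsz·L)^d ≤
O(1)M^dL^{d+1}`. [cite: Balaban1989LargeFieldII, §1 p.386 l.1-3 (the reset; «p₀ large»)] -/
theorem hcondRT_of_small_kappa (b : Budget.Consts) {d j K : ℕ} (hdim : b.d = d)
    {L Nsz r₀ : ℕ} (R : ℕ → ℕ) (hbR : b.R (j + 1) = (R (j + 1) : ℝ)) (hR1 : 1 ≤ R (j + 1))
    (h29 : R (j + 1 + K) ≤ L * R (j + 1)) {κ₁ pR : ℝ} (hκ₁ : 0 ≤ κ₁)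
    (hsmall : κ₁ * ((Nsz : ℝ) * L) ^ d ≤ b.C * b.M ^ d * (L : ℝ) ^ (d + 1))
    (hcondR' : (2 * (2 * (r₀ : ℝ) + 21) ^ d + 1) *
      (b.C * b.M ^ b.d * (L : ℝ) ^ (b.d + 1) * b.R (j + 1) ^ (b.d + 2)) ≤ pR) :
    2 * (2 * (r₀ : ℝ) + 21) ^ d * (b.C * b.M ^ b.d * (L : ℝ) ^ (b.d + 1) * b.R (j + 1) ^ (b.d + 2))
      + κ₁ * (((Nsz : ℝ) * R (j + 1 + K)) ^ d - 1) ≤ pR := by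
  rw [hdim] at hcondR' ⊢
  rw [hbR] at hcondR' ⊢
  have hR1' : (1 : ℝ) ≤ (R (j + 1) : ℝ) := by exact_mod_cast hR1
  have h29' : (R (j + 1 + K) : ℝ) ≤ (L : ℝ) * R (j + 1) := by exact_mod_cast h29
  have hA : (0 : ℝ) ≤ (Nsz : ℝ) * L := by positivity
  -- the terminal constant against ONE unit of Q′
  have h0 : (0 : ℝ) ≤ (Nsz : ℝ) * R (j + 1 + K) := by positivity
  have h1 : ((Nsz : ℝ) * R (j + 1 + K)) ^ d - 1 ≤ (((Nsz : ℝ) * L) * R (j + 1)) ^ d - 1 := by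
    have : (Nsz : ℝ) * R (j + 1 + K) ≤ ((Nsz : ℝ) * L) * R (j + 1) := by
      rw [mul_assoc]; exact mul_le_mul_of_nonneg_left h29' (Nat.cast_nonneg _)
    linarith [pow_le_pow_left₀ h0 this d]
  have h2 := constPow_sub_one_le hA hR1' d 2
  have hRp : (0 : ℝ) ≤ (R (j + 1) : ℝ) ^ (d + 2) := by positivity
  have h3 : κ₁ * (((Nsz : ℝ) * R (j + 1 + K)) ^ d - 1) ≤
      b.C * b.M ^ d * (L : ℝ) ^ (d + 1) * (R (j + 1) : ℝ) ^ (d + 2) :=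
    calc κ₁ * (((Nsz : ℝ) * R (j + 1 + K)) ^ d - 1)
        ≤ κ₁ * (((Nsz : ℝ) * L) ^ d * (R (j + 1) : ℝ) ^ (d + 2)) :=
          mul_le_mul_of_nonneg_left (h1.trans h2) hκ₁
      _ = (κ₁ * ((Nsz : ℝ) * L) ^ d) * (R (j + 1) : ℝ) ^ (d + 2) := by ring
      _ ≤ (b.C * b.M ^ d * (L : ℝ) ^ (d + 1)) * (R (j + 1) : ℝ) ^ (d + 2) := mul_le_mul_of_nonneg_right hsmall hRp
  linarith

/-! ## §4. (C3) The merger clause of `mergeT_controls_ofIndex` -/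

/-- THE TERMINAL CONSTANT AGAINST ONE UNIT OF COST: with `R_{j+1} ≥ 1`, `d_b = d`: `κ₁((Nsz·L·R_{j+1})^d − 1) ≤ cost_{j+1}(1) =
O(1)M^dR_{j+1}^{d+1}` as soon as `κ₁(Nsz·L)^d ≤ O(1)M^d`. [cite: Balaban1989LargeFieldII, (1.86)–(1.88) pp.386–387 («for p₀ large and γ small enough»)] -/
theorem terminalConst_le_cost_one (b : Budget.Consts) {d j : ℕ} (hdim : b.d = d)
    {L Nsz : ℕ} (hR1 : 1 ≤ b.R (j + 1)) {κ₁ : ℝ} (hκ₁ : 0 ≤ κ₁)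
    (hsmall : κ₁ * ((Nsz : ℝ) * L) ^ d ≤ b.C * b.M ^ d) :
    κ₁ * (((Nsz : ℝ) * L * b.R (j + 1)) ^ d - 1) ≤ b.cost (j + 1) 1 := by
  unfold Budget.Consts.cost
  rw [hdim, mul_one]
  have hA : (0 : ℝ) ≤ (Nsz : ℝ) * L := by positivity
  have h1 := constPow_sub_one_le hA hR1 d 1
  have hRp : 0 ≤ b.R (j + 1) ^ (d + 1) := pow_nonneg (by linarith) _
  calc κ₁ * (((Nsz : ℝ) * L * b.R (j + 1)) ^ d - 1)
      ≤ κ₁ * (((Nsz : ℝ) * L) ^ d * b.R (j + 1) ^ (d + 1)) := mul_le_mul_of_nonneg_left h1 hκ₁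
    _ = (κ₁ * ((Nsz : ℝ) * L) ^ d) * b.R (j + 1) ^ (d + 1) := by ring
    _ ≤ (b.C * b.M ^ d) * b.R (j + 1) ^ (d + 1) := mul_le_mul_of_nonneg_right hsmall hRp

/-- **(C3) THE MERGER CLAUSE IS `g`-UNIFORM UP TO PRINT'S OWN CONDITION**: the located condition of
`B16Improved189FullBudgetIndex.mergeT_controls_ofIndex`, `hbudgetT : E + E_t + cost_{j+1}(2) ≤ q` with the terminal constant
`E_t = κ₁((Nsz·L·R_{j+1})^d − 1)` of `terminal_le_located`, follows from print's merger condition «for p₀ large and γ small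
enough» with the junction constant `2` («+2d», tree `+2`) enlarged to `3` — `E + cost_{j+1}(3) ≤ q` (`hbudget3`) — and the
smallness `κ₁(Nsz·L)^d ≤ O(1)M^d`; the additivity of the cost in the size (`Consts.cost_add`). [cite: Balaban1989LargeFieldII, (1.88) p.387 («for p₀ large and γ small enough»)] -/
theorem hbudgetT_of_small_kappa (b : Budget.Consts) {d j : ℕ} (hdim : b.d = d)
    {L Nsz : ℕ} (hR1 : 1 ≤ b.R (j + 1)) {κ₁ E q : ℝ} (hκ₁ : 0 ≤ κ₁)
    (hsmall : κ₁ * ((Nsz : ℝ) * L) ^ d ≤ b.C * b.M ^ d) (hbudget3 : E + b.cost (j + 1) 3 ≤ q) :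
    E + κ₁ * (((Nsz : ℝ) * L * b.R (j + 1)) ^ d - 1) + b.cost (j + 1) 2 ≤ q := by
  have h := terminalConst_le_cost_one b hdim hR1 hκ₁ hsmall
  have hadd : b.cost (j + 1) 3 = b.cost (j + 1) 1 + b.cost (j + 1) 2 := by
    rw [← Budget.Consts.cost_add]; norm_num
  linarith

/-! ## §5. (C4) The doubled slope clause of `B16Improved189ArbitraryRegionFull` -/

/-- **(C4) THE DOUBLED SLOPE CLAUSE**: `2κ₁·c·L^d ≤ O(1)·M^d·R_{k+1}` follows from `2κ₁·c·L^d ≤ O(1)·M^d` since `R_{k+1} ≥ 1` —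
the twin of `B16Improved189ArbitraryRegion.slope_of_small_kappa` for the full-budget route's `hslope2` (constants only; no
`p₀`-budget spent, where the half-budget route needed `deficit_trade_of_exponents`, a `g_k`-smallness). [cite: Balaban1989LargeFieldII, p.387 («for p₀ large and γ small enough»)] -/
theorem hslope2_of_small_kappa {κ₁ c C M L R' : ℝ} {d : ℕ} (hR1 : 1 ≤ R') (hCM : 0 ≤ C * M ^ d)
    (hκ : 2 * (κ₁ * c * L ^ d) ≤ C * M ^ d) : 2 * (κ₁ * c * L ^ d) ≤ C * M ^ d * R' :=
  calc 2 * (κ₁ * c * L ^ d) ≤ C * M ^ d := hκ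
    _ = C * M ^ d * 1 := (mul_one _).symm
    _ ≤ C * M ^ d * R' := mul_le_mul_of_nonneg_left hR1 hCM

/-! ## §6. Non-vacuity: the four smallness conditions of `κ₁` jointly with print's located conditions -/

/-- **The four `κ₁`-smallness conditions (C1)–(C4) are jointly satisfiable by a POSITIVE `κ₁` together with print's located
conditions, and the four clauses then hold**: `O(1) = M = 1`, `d = d_b = 1`, `R ≡ 1`, `L = 4`, `Nsz = 64`, `r₀ = 22`,
`c = 32`, `κ₁ = 1∕256` (`κ₁·(Nsz·L) = 1`): with `E = 0`, `q = 3`, `p = (2·65 + 1)·16` the base, reset, merger and slope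
clauses of the three sibling files follow by §§2–5. [cite: Balaban1989LargeFieldII, p.385, p.386, p.387 (located conditions)] -/
theorem toy_clauses_fullBudget :
    let b : Budget.Consts := ⟨1, 1, 1, fun _ => 1⟩
    let R1 : ℕ → ℕ := fun _ => 1
    (1 / 256 : ℝ) * ((((64 : ℕ) : ℝ) * ((4 : ℕ) : ℝ) * b.R 0) ^ 1 - 1) ≤
        10 * 126 ^ 1 * (b.C * b.M ^ b.d * ((4 : ℕ) : ℝ) ^ (b.d + 1) * b.R 0 ^ (b.d + 2)) ∧
      2 * (2 * ((22 : ℕ) : ℝ) + 21) ^ 1 * (b.C * b.M ^ b.d * ((4 : ℕ) : ℝ) ^ (b.d + 1) * b.R (0 + 1) ^ (b.d + 2))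
          + (1 / 256 : ℝ) * ((((64 : ℕ) : ℝ) * (R1 (0 + 1 + 0) : ℝ)) ^ 1 - 1) ≤ (2 * 65 + 1) * 16 ∧
      (0 : ℝ) + (1 / 256 : ℝ) * ((((64 : ℕ) : ℝ) * ((4 : ℕ) : ℝ) * b.R (0 + 1)) ^ 1 - 1) + b.cost (0 + 1) 2 ≤ 3 ∧
      2 * ((1 / 256 : ℝ) * 32 * (4 : ℝ) ^ 1) ≤ 1 * (1 : ℝ) ^ 1 * b.R (0 + 1) := by
  intro b R1
  have hb1 : ∀ m, b.R m = 1 := fun _ => rfl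
  refine ⟨?_, ?_, ?_, ?_⟩
  · exact hclauseU_of_small_kappa b (d := 1) (m := 0) (L := 4) (Nsz := 64) rfl (by rw [hb1]) (by norm_num)
      (by simp [b]; norm_num)
  · exact hcondRT_of_small_kappa b (d := 1) (j := 0) (K := 0) (L := 4) (Nsz := 64) (r₀ := 22) rfl R1
      (by simp [b, R1]) le_rfl (by norm_num [R1]) (by norm_num) (by simp [b]; norm_num) (by simp [b]; norm_num)
  · exact hbudgetT_of_small_kappa b (d := 1) (j := 0) (L := 4) (Nsz := 64) rfl (by rw [hb1]) (by norm_num)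
      (by simp [b]; norm_num) (by simp [b, Budget.Consts.cost])
  · exact hslope2_of_small_kappa (by rw [hb1]) (by norm_num) (by norm_num)

end Literature.MathematicalPhysics.QuantumFieldTheory.Balaban1983to89.B16Improved189FullBudgetClauses

end
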